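import Summits.QuantumFields.QCD.Theorems.QuarksAsStableActionStableActionBridgeSliceMassHopPosDef

/-!
# Continuity of the fermionic transfer operator `T̂_F(U)` in the gauge background
(helper for crux stmt-QuantumFields-9737 `QuarksAsStableAction.StableActionBridge`, line `Sketch`;
stub `continuous_fermionSliceOp`)

Lüscher's one-step fermionic transfer operator of `r = 1` Wilson quarks in the charge-conserving
form of Smit (6.91),
`T̂_F(U) = fermionSliceOp U mq = (det A(U))² • Γ(reindex M_F(U))`,
`M_F(U) = (1 − N(U)) (A(U)⁻¹ ⊗ P⁺ + A(U) ⊗ P⁻) (1 − N(U)ᴴ)`, `A(U) = sliceMassHop U mq`,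
depends continuously on the background `U ∈ SU(3)^{Edge 3 S}` (product topology) as soon as all
bare masses satisfy `m_f > −1`: then `A(U)` is positive definite (`sliceMassHop_posDef`), so
`det A(U) ≠ 0` for every `U` and the matrix inverse `A(U)⁻¹ = (det A(U))⁻¹ • adj A(U)` inside
`fermionSliceMatrix` is an honest inverse, continuous in `U`.  Every other ingredient
(`colourHop`, `sliceKron`, `sliceDiracKinetic`, `sliceNilp`, `reindex`, the minors of `fockLift`,
`det`, `adjugate`) is polynomial in the link matrix entries.

This continuity is what makes the transfer form `transferForm` / the Rayleigh quotient behind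
`qcdTransferLevel` and `qcdTransferGap` bounded on the core of continuous gauge-invariant wave
functions (compactness of `SU(3)^{links}`).
[cite: Luscher1977, pp. 283–292]; [cite: Smit2023, §6.5 (6.87)–(6.91)].
Pure theorem file (no definitions); the intermediate continuity lemmas are exposed in the
sub-namespace `FermionSliceContinuous` for reuse.
-/

noncomputable section

namespace Summit.QuantumFields.QCD.Cruxes.StableActionBridge.Sketch

open scoped ComplexOrder
open MeasureTheory Matrix
open Literature.MathematicalPhysics.QuantumFieldTheory Literature.MathematicalPhysics.QuantumLattice

namespace FermionSliceContinuous

/-! ### Generic part: the Fock functor `Γ` is continuous -/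

/-- **The Fock functor `Γ` is continuous**: every entry `Γ(X)_{s,t}` is a fixed minor of `X`
(or `0`), a polynomial in the entries of `X`. [folklore] -/
theorem continuous_fockLift {ι : Type*} [LinearOrder ι] {X : Type*} [TopologicalSpace X]
    {A : X → Matrix ι ι ℂ} (hA : Continuous A) : Continuous fun x => fockLift (A x) := by
  refine continuous_matrix fun s t => ?_
  by_cases h : t.card = s.card
  · simp only [fockLift, Matrix.of_apply, dif_pos h]
    exact (hA.matrix_submatrix _ _).matrix_det
  · simp only [fockLift, Matrix.of_apply, dif_neg h]
    exact continuous_const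

/-! ### The slice matrices are continuous in the background `U` -/

variable {Nf S : ℕ}

/-- **The forward colour hop `W_j(U)` is continuous in `U`**: each entry is either `0` or a link
matrix entry `U(x, j)_{ab}`. [folklore] -/
theorem continuous_colourHop (j : Fin 3) :
    Continuous fun U : GaugeConfig 3 S (Matrix.specialUnitaryGroup (Fin 3) ℂ) =>
      colourHop (Nf := Nf) U j := by
  refine continuous_matrix fun p q => ?_
  have hentry : Continuous fun U : GaugeConfig 3 S (Matrix.specialUnitaryGroup (Fin 3) ℂ) =>
      (U (p.2.1, j) : Matrix (Fin 3) (Fin 3) ℂ) p.2.2 q.2.2 :=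
    (continuous_apply (p.2.1, j)).subtype_val.matrix_elem p.2.2 q.2.2
  simp only [colourHop, Matrix.of_apply]
  exact hentry.if_const _ continuous_const

/-- **Smit's `A(U) = diag(m_f + 4) − ½ Σ_j (W_j + W_jᴴ)` is continuous in `U`.** [folklore] -/
theorem continuous_sliceMassHop (mq : Fin Nf → ℝ) :
    Continuous fun U : GaugeConfig 3 S (Matrix.specialUnitaryGroup (Fin 3) ℂ) =>
      sliceMassHop U mq := by
  have hsum : Continuous fun U : GaugeConfig 3 S (Matrix.specialUnitaryGroup (Fin 3) ℂ) =>
      ∑ j : Fin 3, (colourHop (Nf := Nf) U j + (colourHop U j)ᴴ) :=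
    continuous_finsetSum _ fun j _ =>
      (continuous_colourHop j).fun_add (continuous_colourHop j).matrix_conjTranspose
  unfold sliceMassHop
  exact continuous_const.fun_sub (hsum.fun_const_smul _)

/-- `B ↦ B ⊗ Γ` (`sliceKron`) is continuous in the spin-blind factor `B`. [folklore] -/
theorem continuous_sliceKron {X : Type*} [TopologicalSpace X]
    {B : X → Matrix (SliceColourVar Nf S) (SliceColourVar Nf S) ℂ} (hB : Continuous B)
    (Γ : Matrix (Fin 4) (Fin 4) ℂ) : Continuous fun x => sliceKron (B x) Γ := by
  refine continuous_matrix fun p q => ?_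
  simp only [sliceKron, Matrix.of_apply]
  exact (hB.matrix_elem _ _).fun_mul continuous_const

/-- **Smit's `D(U) = ½ Σ_j (W_j − W_jᴴ) ⊗ γ₄γ_j` is continuous in `U`.** [folklore] -/
theorem continuous_sliceDiracKinetic :
    Continuous fun U : GaugeConfig 3 S (Matrix.specialUnitaryGroup (Fin 3) ℂ) =>
      sliceDiracKinetic (Nf := Nf) U := by
  have hsum : Continuous fun U : GaugeConfig 3 S (Matrix.specialUnitaryGroup (Fin 3) ℂ) =>
      ∑ j : Fin 3, sliceKron (Nf := Nf) (colourHop U j - (colourHop U j)ᴴ)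
        (euclideanGamma 0 * euclideanGamma j.succ) :=
    continuous_finsetSum _ fun j _ =>
      continuous_sliceKron
        ((continuous_colourHop j).fun_sub (continuous_colourHop j).matrix_conjTranspose) _
  unfold sliceDiracKinetic
  exact hsum.fun_const_smul _

variable [NeZero S]

/-- **The determinant `det A(U)` is continuous in `U`.** [folklore] -/
theorem continuous_sliceMassHop_det (mq : Fin Nf → ℝ) :
    Continuous fun U : GaugeConfig 3 S (Matrix.specialUnitaryGroup (Fin 3) ℂ) =>
      (sliceMassHop U mq).det :=
  (continuous_sliceMassHop mq).matrix_det

/-- For `m_f > −1` the determinant `det A(U)` never vanishes (`A(U)` is positive definite).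
[cite: Luscher1977, pp. 283–292] -/
theorem sliceMassHop_det_ne_zero (U : GaugeConfig 3 S (Matrix.specialUnitaryGroup (Fin 3) ℂ))
    (mq : Fin Nf → ℝ) (hm : ∀ f, -1 < mq f) : (sliceMassHop U mq).det ≠ 0 :=
  (sliceMassHop_posDef Nf S U mq hm).det_pos.ne'

/-- **For `m_f > −1` the inverse `A(U)⁻¹` is continuous in `U`**:
`A⁻¹ = (det A)⁻¹ • adj A` with `det A(U) ≠ 0` everywhere. [folklore] -/
theorem continuous_sliceMassHop_inv (mq : Fin Nf → ℝ) (hm : ∀ f, -1 < mq f) :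
    Continuous fun U : GaugeConfig 3 S (Matrix.specialUnitaryGroup (Fin 3) ℂ) =>
      (sliceMassHop U mq)⁻¹ := by
  simp_rw [Matrix.inv_def, Ring.inverse_eq_inv]
  exact ((continuous_sliceMassHop_det mq).fun_inv₀ fun U =>
    sliceMassHop_det_ne_zero U mq hm).fun_smul (continuous_sliceMassHop mq).matrix_adjugate

/-- **The nilpotent pair coupling `N(U) = P⁻ D(U) P⁺` is continuous in `U`.** [folklore] -/
theorem continuous_sliceNilp :
    Continuous fun U : GaugeConfig 3 S (Matrix.specialUnitaryGroup (Fin 3) ℂ) =>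
      sliceNilp (Nf := Nf) U := by
  unfold sliceNilp
  exact (continuous_const.matrix_mul continuous_sliceDiracKinetic).matrix_mul continuous_const

/-- **The one-particle transfer matrix `M_F(U) = (1 − N)(A⁻¹ ⊗ P⁺ + A ⊗ P⁻)(1 − Nᴴ)` is
continuous in `U` for `m_f > −1`.** [cite: Smit2023, §6.5 (6.91)] -/
theorem continuous_fermionSliceMatrix (mq : Fin Nf → ℝ) (hm : ∀ f, -1 < mq f) :
    Continuous fun U : GaugeConfig 3 S (Matrix.specialUnitaryGroup (Fin 3) ℂ) =>
      fermionSliceMatrix U mq := by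
  unfold fermionSliceMatrix
  exact ((continuous_const.fun_sub continuous_sliceNilp).matrix_mul
    ((continuous_sliceKron (continuous_sliceMassHop_inv mq hm) _).fun_add
      (continuous_sliceKron (continuous_sliceMassHop mq) _))).matrix_mul
    (continuous_const.fun_sub continuous_sliceNilp.matrix_conjTranspose)

end FermionSliceContinuous

/-- **Continuity of the fermionic transfer operator in the background** (stub
`continuous_fermionSliceOp` of line `Sketch`): for all bare masses `m_f > −1` the map
`U ↦ T̂_F(U) = (det A(U))² • Γ(reindex M_F(U))` from `SU(3)^{Edge 3 S}` to the matrices on the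
slice Fock space is continuous (`A(U) = sliceMassHop U mq` is positive definite, so its inverse in
`M_F(U)` is a genuine, continuous inverse; everything else is polynomial in the links).
[cite: Luscher1977, pp. 283–292]; [cite: Smit2023, §6.5 (6.87)–(6.91)]. -/
theorem continuous_fermionSliceOp : ∀ (Nf S : ℕ) [NeZero S] (mq : Fin Nf → ℝ), (∀ f, -1 < mq f) → Continuous fun U : GaugeConfig 3 S (Matrix.specialUnitaryGroup (Fin 3) ℂ) => fermionSliceOp (Nf := Nf) U mq := by
  intro Nf S _ mq hm
  unfold fermionSliceOp
  exact ((FermionSliceContinuous.continuous_sliceMassHop_det mq).fun_pow 2).fun_smul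
    (FermionSliceContinuous.continuous_fockLift
      ((FermionSliceContinuous.continuous_fermionSliceMatrix mq hm).matrix_reindex _ _))

end Summit.QuantumFields.QCD.Cruxes.StableActionBridge.Sketch

end
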